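import Mathlib.Analysis.SpecialFunctions.Pow.Real
import Literature.Computability.QuantumComplexity.SimonFourier
import Literature.Computability.QuantumComplexity.ForrelationIdleWires
import HarnessLib

/-!
# A single-query IQP circuit for signed 2-Forrelation: Buzet–Chailloux 2026, Theorems 1 and 2, proved

Family `quantum-advantage`, topic `Literature/Computability/QuantumComplexity`. Q. Buzet,
A. Chailloux, *IQP circuits for 2-Forrelation* (arXiv:2604.15248, 2026): an IQP circuit on `n + 1`
qubits making ONE query to the phase oracle `O_{f,g}` whose acceptance probability is an exact affine
function of the signed forrelation `Φ(f,g)`. Source read: arXiv:2604.15248v1, pp. 6–8 and 16–24.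
Verbatim:

* Thm. 1 (p. 6 = p. 16): "Let functions `f, g : {0,1}ⁿ → {-1,1}`. There exists an IQP computation
  making a single quantum query to `O_{f,g}` that accepts with probability
  `P_acc = 1/2 + Φ(f,g)/(2√2)` if `n` odd, `P_acc = 1/2 + Φ(f,g)/4` if `n` even", where (p. 4)
  `Φ(f,g) = 2^{-3n/2} ∑_{x,y} (-1)^{x·y} f(x) g(y)`; Thm. 2 (p. 9 = p. 23): "There exists an IQP
  computation making 2 quantum queries to `O_{f,g}` that accepts with probability
  `P_acc = 1/2 + Φ²(f,g)/4` if `n` odd, `1/2 + Φ²(f,g)/8` if `n` even" (proof p. 24: "Run the IQP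
  computation of Theorem 1 twice independently, and accept if and only if both runs give the same
  outcome").
* §3.1 (p. 17): "IQP circuits are of the following form `|0^{n+1}⟩ — H^{⊗(n+1)} — O_{f,g} — D —
  H^{⊗(n+1)} — Π_F` where `D = ∑_x ρ(x)|x⟩⟨x|` with `|ρ| = 1` is a diagonal operator in the
  computational basis, and we include the classical post-processing `Π_F` which accepts when the
  output of the IQP circuit is in `F ⊆ {0,1}^{n+1}`." Prop. 1 and its proof (pp. 17–18):
  "`D = ∑_x ρ₀(x)|0x⟩⟨0x| + ρ₁(x)|1x⟩⟨1x|`. […] Let `T = {x : σ̂(x) = 1}` meaning `σ̂ = (-1)^{1_T̄}`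
  and `F = {0} × T ∪ {1} × T̄`. […] After the first Hadamards, we get `2^{-(n+1)/2} ∑_{b,x} |b⟩|x⟩`.
  After applying `O_{f,g}` and then `D`, we obtain `2^{-(n+1)/2} ∑_x ρ₀(x)f(x)|0⟩|x⟩ + ρ₁(x)g(x)|1⟩|x⟩`.
  We set `a(x) = ρ₀(x)f(x)` and `b(x) = ρ₁(x)g(x)` […] Applying the final `H^{⊗(n+1)}`, we get
  `2^{-(n+2)/2} ∑_x (â(x) + b̂(x))|0⟩|x⟩ + (â(x) - b̂(x))|1⟩|x⟩` […]
  `P_acc = 2^{-(n+2)} [∑_{x∈T} (â(x) + b̂(x))² + ∑_{x∈T̄} (â(x) - b̂(x))²]` […] Parseval's identity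
  gives `∑_x â²(x) = ∑_x b̂²(x) = 2ⁿ` […] `P_acc = 1/2 + 2^{-(n+1)} ∑_x â(x)b̂(x)σ̂(x)` […] convolution
  formula: `∑_x â(x)b̂(x)σ̂(x) = 2^{-n/2} ∑_{x,y} a(x)b(y)σ(x + y)` […]
  `P_acc = 1/2 + √(1/2^{3n+2}) ∑_{x,y} f(x)g(y)ρ₀(x)ρ₁(y)σ(x + y)`." Here (p. 7)
  "`ĥ(x) = 2^{-n/2} ∑_y (-1)^{x·y} h(y)`".
* Def. 5 (p. 19): "define `Q(x) = ∑_{1≤i<j≤n} xᵢxⱼ`. The function `Q` satisfies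
  `Q(x) ≡ binom(|x|, 2) mod 2`"; Prop. 4 (p. 19): "For all `x, y ∈ {0,1}ⁿ`,
  `Q(x) + Q(y) + Q(x + y) = x·y + |x||y| mod 2`." with the proof
  "`∑_{i<j} xᵢxⱼ + yᵢyⱼ + (xᵢ + yᵢ)(xⱼ + yⱼ) = ∑_{i<j} (xᵢyⱼ + yᵢxⱼ) = (∑ᵢ xᵢ)(∑ⱼ yⱼ) - ∑ᵢ xᵢyᵢ`".
* Prop. 5 (p. 20; `n` odd): "`ρ₀ = ρ₁ = (-1)^Q`", "`σ(x) = √2 (-1)^{Q(x)}` if `|x|` odd, `0` otherwise",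
  "`P_acc = 1/2 + Φ_odd(f,g)/√2`"; Lemma 1: "`σ̂(x) = √2 sin(π(n - 2|x|)/4)`. In particular, when `n`
  is odd, `|σ̂(x)| = 1` for all `x`." Prop. 6 (p. 21): "`ρ₀(x) = (-1)^{Q(x)}`, `ρ₁(x) = (-1)^{Q(x)+|x|}`",
  "`σ(x) = √2 (-1)^{Q(x)}` if `|x|` is even, `0` otherwise", "`P_acc = 1/2 + Φ_even(f,g)/√2`";
  Lemma 2: "`σ̂(x) = √2 cos(π(n - 2|x|)/4)`. In particular, when `n` is odd, `|σ̂(x)| = 1`";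
  `Φ_odd/even(f,g) = 2^{-3n/2} ∑_{|x+y| odd/even} f(x)g(y)(-1)^{x·y}` (p. 19); Prop. 7 (p. 22): "Draw
  a uniform random bit `r`. If `r = 0`, run the circuit of Proposition 5; if `r = 1`, run the
  circuit of Proposition 6. The overall accepting probability is […] `1/2 + Φ(f,g)/(2√2)`."
* Def. 6 and Prop. 8 (p. 23; `n` even): "`f̄(x₁, …, x_{n+1}) = f(x₁, …, xₙ)`", "Since `n + 1` is odd,
  we apply Proposition 7 to `f̄` and `ḡ` […] `Φ(f̄, ḡ) = Φ(f,g)/√2` […] `P_acc = 1/2 + Φ(f,g)/4`."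

## Rendering, and what is proved (EVERYTHING below is a theorem; the file adds no named fact)

The oracle `O_{f,g}` is the diagonal phase `|b x⟩ ↦ o_b(x)|b x⟩`, `o₀ = f`, `o₁ = g` (`oracle f g`),
for `f g : {0,1}ⁿ → ℝ` with `f(x)² = g(x)² = 1`; `D` is `|b x⟩ ↦ ρ_b(x)|b x⟩`. Since
`⟨b x| H^{⊗(n+1)} |b' x'⟩ = 2^{-(n+1)/2} (-1)^{bb' + x·x'}`, the output amplitude of the circuit of
§3.1 on input `|0^{n+1}⟩` is
`⟨b x| H^{⊗(n+1)} D O_{f,g} H^{⊗(n+1)} |0^{n+1}⟩ = 2^{-(n+1)} ∑_{b',x'} (-1)^{bb'} (-1)^{x·x'} ρ_{b'}(x') o_{b'}(x')`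
— this closed finite sum is the DEFINITION `iqpAmplitude ρ o b x` (all data are real, so no complex
numbers are needed), `iqpAccProb ρ o F = ∑_{(b,x) ∈ F} amplitude²` is the Born probability of
landing in the accepting set `F ⊆ {0,1} × {0,1}ⁿ`, and `accSet T = {0} × T ∪ {1} × T̄`,
`bentSet σ = {x : σ̂(x) = 1}`. (The tree's gate-level `QCircuit`/`iqpUnitary` semantics is not used —
the item asked for the identity over the amplitude sum; `hGateAll_apply_eq_twist` of
`ForrelationCompleteProofs` is the bridge to `H^{⊗m}` if wanted. The "IQP computation" of Thm. 1 =
a fair classical coin choosing one of the two circuits (Prop. 7, Remark 1) is `thm1AccProb`, the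
average of the two acceptance probabilities; that of Thm. 2 is `thm2AccProb = P² + (1 - P)²`.)
Characters `(-1)^{x·y}` are the tree's `twist x y` (`Forrelation.lean`) with the lemmas of
`SimonFourier.lean` (`twist_xor_left`, `sum_twist`, `twist_mul_self`, `twist_eq_neg_one_pow`) and
`twist_snoc` (`ForrelationIdleWires.lean`), reused.

Proved, in order: bit-vector bookkeeping (`|x ⊕ y| + 2·overlap = |x| + |y|`); the parity-restricted
character sums `2 ∑_{|y| odd} (-1)^{y·z} = 2ⁿ[z = 0] - 2ⁿ[z = 1ⁿ]`, `2 ∑_{|y| even} (-1)^{y·z} =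
2ⁿ[z = 0] + 2ⁿ[z = 1ⁿ]`; `qSign x = ∏_{i<j} (-1)^{xᵢxⱼ} = (-1)^{Q(x)}` and **Prop. 4 in sign form**
(`qSign_mul_qSign_mul_qSign_bxor`, by the printed manipulation); the transform `hat`, the
autocorrelation and `ĥ(x)² = 2^{-n} ∑_z (-1)^{x·z} C_h(z)`; **bentness for `n` odd** — the "in
particular" clauses of Lemmas 1–2, which is all that Prop. 1 consumes: `σ̂_odd(x)² = σ̂_even(x)² = 1`,
proved WITHOUT the closed trigonometric forms, through `∑_y σ(y)σ(y ⊕ z) = 2ⁿ[z = 0]` (Prop. 4 reduces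
it to the parity-restricted character sums, and `n` odd excludes `z = 1ⁿ`); Plancherel and the
convolution formula; **Prop. 1** (`iqpAccProb_accSet_eq`); **Props. 5, 6**; **Theorem 1 for `n` odd**
(`BuzetChailloux2026_thm1_odd`: `thm1AccProb f g = 1/2 + Φ(f,g)/(2√2)` exactly) and, over the tree's
`forrelation` for Boolean data, `BuzetChailloux2026_thm1_odd_forrelation`; **Prop. 8 / Theorem 1 for
`n` even** (`phi_pad : Φ(f̄,ḡ) = Φ(f,g)/√2`, `BuzetChailloux2026_thm1_even : … = 1/2 + Φ(f,g)/4`);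
**Theorem 2** (`BuzetChailloux2026_thm2_odd/even`: `1/2 + Φ²/4`, `1/2 + Φ²/8`).

NOT here: the closed forms `σ̂ = √2 sin / cos(π(n - 2|x|)/4)` of Lemmas 1–2 (needed in print only for
the EFFICIENT computability of the accepting set `T`, i.e. for the complexity-class reading, not for
the identities); the relativized separation Thm. 3/5, `(BPP^IQP)^O ⊄ PH^O` with non-adaptive calls
(Remark 2) — it needs the class `BPP^IQP` (requested elsewhere as the definition item `BPPSampIQP`)
on top of the tree's Raz–Tal facts (`OracleSeparationBQPPH`), and its quantitative input is exactly
Thm. 2 here; Thm. 4 (Fourier growth `‖p̂‖₁ ≤ √min(|F|, 2ⁿ)`); Prop. 3 (impossibility without parity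
splitting).

## References

* [BuzetChailloux2026] Q. Buzet, A. Chailloux, IQP circuits for 2-Forrelation, arXiv:2604.15248
  (2026), §3.1 Prop. 1, Def. 5, Prop. 4, §3.4 Props. 5–6 with Lemmas 1–2, §3.5 Prop. 7, Def. 6,
  Prop. 8, Thm. 1, Thm. 2.
* [AaronsonAmbainis2018] S. Aaronson, A. Ambainis, Forrelation, SIAM J. Comput. 47 (2018), §1.1.1.
* [ODonnell2014] R. O'Donnell, Analysis of Boolean Functions (2014), §1.4 (characters, Parseval).
-/

noncomputable section

namespace Literature.Computability.QuantumComplexity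

namespace BuzetChailloux

open Finset Simon

variable {n : ℕ}

/-! ### Bit vectors: xor, Hamming weight, the all-ones vector -/

/-- Pointwise xor `x ⊕ y` of bit vectors (the paper's `x + y`). [cite: BuzetChailloux2026, Prop. 4] -/
abbrev bxor (x y : Fin n → Bool) : Fin n → Bool := fun i => x i ^^ y i

/-- The Hamming weight `|x|`. [cite: BuzetChailloux2026, Def. 5] -/
def hw (x : Fin n → Bool) : ℕ := (univ.filter fun i => x i = true).card

/-- The all-ones vector `1ⁿ`. [folklore] -/
def allOnes : Fin n → Bool := fun _ => true

/-- The zero vector `0ⁿ`. [folklore] -/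
def zeroVec : Fin n → Bool := fun _ => false

/-- `|0ⁿ| = 0`. [folklore] -/
@[simp] theorem hw_zeroVec : hw (zeroVec : Fin n → Bool) = 0 := by simp [hw, zeroVec]

/-- `|1ⁿ| = n`. [folklore] -/
@[simp] theorem hw_allOnes : hw (allOnes : Fin n → Bool) = n := by simp [hw, allOnes]

/-- `x ⊕ y = y ⊕ x`. [folklore] -/
theorem bxor_comm (x y : Fin n → Bool) : bxor x y = bxor y x := by
  funext i; exact Bool.xor_comm _ _

/-- `x ⊕ x = 0`. [folklore] -/
@[simp] theorem bxor_self (x : Fin n → Bool) : bxor x x = zeroVec := by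
  funext i; simp [zeroVec]

/-- `x ⊕ 0 = x`. [folklore] -/
@[simp] theorem bxor_zeroVec (x : Fin n → Bool) : bxor x zeroVec = x := by
  funext i; simp [bxor, zeroVec]

/-- `0 ⊕ x = x`. [folklore] -/
@[simp] theorem zeroVec_bxor (x : Fin n → Bool) : bxor zeroVec x = x := by
  funext i; simp [bxor, zeroVec]

/-- `x ⊕ (x ⊕ y) = y` (xor with `x` is an involution). [folklore] -/
@[simp] theorem bxor_bxor_cancel_left (x y : Fin n → Bool) : bxor x (bxor x y) = y := by
  funext i; simp

/-- `x ⊕ y = 0 ↔ x = y`. [folklore] -/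
theorem bxor_eq_zeroVec_iff (x y : Fin n → Bool) : bxor x y = zeroVec ↔ x = y := by
  constructor
  · intro h; funext i
    have := congrFun h i
    simpa [zeroVec] using this
  · rintro rfl; exact bxor_self x

/-- `z ⊕ 1ⁿ = 0 ↔ z = 1ⁿ`. [folklore] -/
theorem bxor_allOnes_eq_zeroVec_iff (z : Fin n → Bool) : bxor z allOnes = zeroVec ↔ z = allOnes := by
  rw [bxor_eq_zeroVec_iff]

/-- Xor with a fixed vector is an involution of `{0,1}ⁿ`, packaged as a permutation (used to
reindex sums `y' = y ⊕ z`). [folklore] -/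
def bxorPerm (x : Fin n → Bool) : Equiv.Perm (Fin n → Bool) :=
  Function.Involutive.toPerm (bxor x) (bxor_bxor_cancel_left x)

/-- The permutation `bxorPerm x` is `y ↦ x ⊕ y`. [folklore] -/
@[simp] theorem bxorPerm_apply (x y : Fin n → Bool) : bxorPerm x y = bxor x y := rfl

/-- The overlap count `#{i : xᵢ = yᵢ = 1}` (so that `x·y ≡ overlap mod 2`). [folklore] -/
def overlap (x y : Fin n → Bool) : ℕ := (univ.filter fun i => x i && y i).card

/-- `|x ⊕ y| + 2 (x·y as a count) = |x| + |y|`. [cite: BuzetChailloux2026, Prop. 4] -/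
theorem hw_bxor_add (x y : Fin n → Bool) : hw (bxor x y) + 2 * overlap x y = hw x + hw y := by
  classical
  have key : ∀ i : Fin n, ((if (x i ^^ y i) = true then 1 else 0) + 2 * (if (x i && y i) = true then 1 else 0) : ℕ)
      = (if x i = true then 1 else 0) + (if y i = true then 1 else 0) := by
    intro i; cases x i <;> cases y i <;> simp
  simp only [hw, overlap, card_filter, mul_sum]
  rw [← sum_add_distrib, ← sum_add_distrib]
  exact sum_congr rfl fun i _ => key i

/-- Parity of the weight of a xor: `|x ⊕ y| ≡ |x| + |y| (mod 2)`. [cite: BuzetChailloux2026, Prop. 6 (proof)] -/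
theorem even_hw_bxor_iff (x y : Fin n → Bool) : Even (hw (bxor x y)) ↔ Even (hw x + hw y) := by
  rw [← hw_bxor_add x y, Nat.even_add]
  exact (iff_true_right (even_two_mul _)).symm

/-! ### The characters `(-1)^{x·y}` (`twist`): right multiplicativity and the sign `(-1)^{|x|}` -/

/-- `(-1)^{x·(y ⊕ z)} = (-1)^{x·y} (-1)^{x·z}`. [cite: ODonnell2014, §1.4] -/
theorem twist_bxor_right (x y z : Fin n → Bool) : twist x (bxor y z) = twist x y * twist x z := by
  rw [twist_comm, show bxor y z = fun i => y i ^^ z i from rfl, twist_xor_left, twist_comm y,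
    twist_comm z]

/-- `(-1)^{x·1ⁿ} = (-1)^{|x|}`. [folklore] -/
theorem twist_allOnes (x : Fin n → Bool) : twist x allOnes = (-1) ^ hw x := by
  rw [twist_eq_neg_one_pow, hw]
  congr 2
  ext i; simp [allOnes]

/-- `(-1)^{x·0} = 1`. [folklore] -/
theorem twist_zeroVec_right (x : Fin n → Bool) : twist x zeroVec = 1 := by
  simp [twist, zeroVec]

/-- **Orthogonality of characters, right form**: `∑_y (-1)^{y·z} = 2ⁿ [z = 0]`.
[cite: ODonnell2014, §1.4] -/
theorem sum_twist_left (z : Fin n → Bool) :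
    ∑ y : Fin n → Bool, twist y z = if z = zeroVec then (2 : ℝ) ^ n else 0 := by
  simp_rw [twist_comm _ z]
  exact sum_twist z

/-- `2 · [|y| odd] = 1 - (-1)^{|y|}`. [folklore] -/
theorem two_mul_indicator_odd (y : Fin n → Bool) :
    (2 : ℝ) * (if Odd (hw y) then 1 else 0) = 1 - (-1) ^ hw y := by
  rcases Nat.even_or_odd (hw y) with h | h
  · rw [if_neg (Nat.not_odd_iff_even.2 h), h.neg_one_pow]; ring
  · rw [if_pos h, h.neg_one_pow]; ring

/-- `2 · [|y| even] = 1 + (-1)^{|y|}`. [folklore] -/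
theorem two_mul_indicator_even (y : Fin n → Bool) :
    (2 : ℝ) * (if Even (hw y) then 1 else 0) = 1 + (-1) ^ hw y := by
  rcases Nat.even_or_odd (hw y) with h | h
  · rw [if_pos h, h.neg_one_pow]; ring
  · rw [if_neg (Nat.not_even_iff_odd.2 h), h.neg_one_pow]; ring

/-- **Characters summed over odd-weight vectors**: `2 ∑_{|y| odd} (-1)^{y·z} = 2ⁿ[z = 0] - 2ⁿ[z = 1ⁿ]`.
[cite: ODonnell2014, §1.4] -/
theorem two_mul_sum_odd_twist (z : Fin n → Bool) :
    2 * ∑ y : Fin n → Bool, (if Odd (hw y) then twist y z else 0) =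
      (if z = zeroVec then (2 : ℝ) ^ n else 0) - (if z = allOnes then (2 : ℝ) ^ n else 0) := by
  have h1 : ∀ y : Fin n → Bool, (2 : ℝ) * (if Odd (hw y) then twist y z else 0)
      = twist y z - twist y (bxor z allOnes) := by
    intro y
    rw [twist_bxor_right, twist_allOnes]
    have := two_mul_indicator_odd y
    split_ifs with h
    · rw [if_pos h] at this; linear_combination (twist y z) * this
    · rw [if_neg h] at this; linear_combination (twist y z) * this
  rw [mul_sum, sum_congr rfl fun y _ => h1 y, sum_sub_distrib, sum_twist_left, sum_twist_left]
  by_cases hz : z = allOnes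
  · rw [if_pos ((bxor_allOnes_eq_zeroVec_iff z).2 hz), if_pos hz]
  · rw [if_neg (mt (bxor_allOnes_eq_zeroVec_iff z).1 hz), if_neg hz]

/-- **Characters summed over even-weight vectors**: `2 ∑_{|y| even} (-1)^{y·z} = 2ⁿ[z = 0] + 2ⁿ[z = 1ⁿ]`.
[cite: ODonnell2014, §1.4] -/
theorem two_mul_sum_even_twist (z : Fin n → Bool) :
    2 * ∑ y : Fin n → Bool, (if Even (hw y) then twist y z else 0) =
      (if z = zeroVec then (2 : ℝ) ^ n else 0) + (if z = allOnes then (2 : ℝ) ^ n else 0) := by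
  have h1 : ∀ y : Fin n → Bool, (2 : ℝ) * (if Even (hw y) then twist y z else 0)
      = twist y z + twist y (bxor z allOnes) := by
    intro y
    rw [twist_bxor_right, twist_allOnes]
    have := two_mul_indicator_even y
    split_ifs with h
    · rw [if_pos h] at this; linear_combination (twist y z) * this
    · rw [if_neg h] at this; linear_combination (twist y z) * this
  rw [mul_sum, sum_congr rfl fun y _ => h1 y, sum_add_distrib, sum_twist_left, sum_twist_left]
  by_cases hz : z = allOnes
  · rw [if_pos ((bxor_allOnes_eq_zeroVec_iff z).2 hz), if_pos hz]
  · rw [if_neg (mt (bxor_allOnes_eq_zeroVec_iff z).1 hz), if_neg hz]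

/-- For `n` odd and `|z|` even, `z ≠ 1ⁿ`. [cite: BuzetChailloux2026, Prop. 5 (proof)] -/
theorem ne_allOnes_of_even (hn : Odd n) {z : Fin n → Bool} (hz : Even (hw z)) : z ≠ allOnes := by
  rintro rfl
  rw [hw_allOnes] at hz
  exact (Nat.not_even_iff_odd.2 hn) hz

/-- For `n` odd: `2 ∑_{|y| odd} (-1)^{y·z} = 2ⁿ[z = 0]` whenever `|z|` is even.
[cite: BuzetChailloux2026, Lemma 1] -/
theorem two_mul_sum_odd_twist_of_even (hn : Odd n) {z : Fin n → Bool} (hz : Even (hw z)) :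
    2 * ∑ y : Fin n → Bool, (if Odd (hw y) then twist y z else 0) =
      if z = zeroVec then (2 : ℝ) ^ n else 0 := by
  rw [two_mul_sum_odd_twist, if_neg (ne_allOnes_of_even hn hz), sub_zero]

/-- For `n` odd: `2 ∑_{|y| even} (-1)^{y·z} = 2ⁿ[z = 0]` whenever `|z|` is even.
[cite: BuzetChailloux2026, Lemma 2] -/
theorem two_mul_sum_even_twist_of_even (hn : Odd n) {z : Fin n → Bool} (hz : Even (hw z)) :
    2 * ∑ y : Fin n → Bool, (if Even (hw y) then twist y z else 0) =
      if z = zeroVec then (2 : ℝ) ^ n else 0 := by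
  rw [two_mul_sum_even_twist, if_neg (ne_allOnes_of_even hn hz), add_zero]

/-! ### The quadratic phase `(-1)^{Q(x)}` and Proposition 4 -/

/-- The sign `(-1)^{[a][b]}` of two bits. [folklore] -/
def bsgn (a b : Bool) : ℝ := if a && b then -1 else 1

/-- `((-1)^{[a][b]})² = 1`. [folklore] -/
@[simp] theorem bsgn_mul_self (a b : Bool) : bsgn a b * bsgn a b = 1 := by
  unfold bsgn; split_ifs <;> norm_num

/-- **`(-1)^{Q(x)}` with `Q(x) = ∑_{i<j} xᵢxⱼ`** (Def. 5), as the product `∏_{i<j} (-1)^{xᵢxⱼ}`; a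
`CZ` gate on every pair of qubits realises this phase. [cite: BuzetChailloux2026, Def. 5] -/
def qSign (x : Fin n → Bool) : ℝ := ∏ i, ∏ j, if i < j then bsgn (x i) (x j) else 1

/-- `((-1)^{Q(x)})² = 1`. [folklore] -/
theorem qSign_mul_self (x : Fin n → Bool) : qSign x * qSign x = 1 := by
  rw [qSign, ← prod_mul_distrib]
  refine prod_eq_one fun i _ => ?_
  rw [← prod_mul_distrib]
  refine prod_eq_one fun j _ => ?_
  split_ifs <;> simp

/-- `(-1)^{Q(0)} = 1`. [folklore] -/
@[simp] theorem qSign_zeroVec : qSign (zeroVec : Fin n → Bool) = 1 := by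
  simp [qSign, zeroVec, bsgn]

/-- `twist x y = ∏ᵢ (-1)^{xᵢyᵢ}` in terms of `bsgn`. [folklore] -/
theorem twist_eq_prod_bsgn (x y : Fin n → Bool) : twist x y = ∏ i, bsgn (x i) (y i) := rfl

/-- The pairwise identity behind Prop. 4:
`(-1)^{xᵢxⱼ + yᵢyⱼ + (xᵢ⊕yᵢ)(xⱼ⊕yⱼ)} = (-1)^{xᵢyⱼ} (-1)^{xⱼyᵢ}`. [cite: BuzetChailloux2026, Prop. 4 (proof)] -/
theorem bsgn_pair (a b c d : Bool) :
    bsgn a b * bsgn c d * bsgn (a ^^ c) (b ^^ d) = bsgn a d * bsgn b c := by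
  cases a <;> cases b <;> cases c <;> cases d <;> simp [bsgn]

/-- `∏ⱼ (-1)^{a yⱼ} = ((-1)^{|y|})^{[a]}`. [folklore] -/
theorem prod_bsgn_const_left (a : Bool) (y : Fin n → Bool) :
    ∏ j, bsgn a (y j) = if a then (-1) ^ hw y else 1 := by
  cases a
  · simp [bsgn]
  · simp only [bsgn, Bool.true_and, ite_true]
    rw [prod_ite, prod_const_one, mul_one, prod_const, hw]

/-- `∏ᵢ ∏ⱼ (-1)^{xᵢyⱼ} = (-1)^{|x||y|}`. [cite: BuzetChailloux2026, Prop. 4 (proof)] -/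
theorem prod_prod_bsgn (x y : Fin n → Bool) :
    ∏ i, ∏ j, bsgn (x i) (y j) = (-1) ^ (hw x * hw y) := by
  simp_rw [prod_bsgn_const_left]
  rw [prod_ite, prod_const_one, mul_one, prod_const, mul_comm, pow_mul, hw]
  congr 1

/-- **Proposition 4 (sign form)**: `(-1)^{Q(x)} (-1)^{Q(y)} (-1)^{Q(x⊕y)} = (-1)^{|x||y|} (-1)^{x·y}`,
i.e. `Q(x) + Q(y) + Q(x + y) = x·y + |x||y| mod 2`. Proof as printed: pairwise
`xᵢxⱼ + yᵢyⱼ + (xᵢ+yᵢ)(xⱼ+yⱼ) ≡ xᵢyⱼ + yᵢxⱼ`, and `∑_{i≠j} xᵢyⱼ = |x||y| - x·y`.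
[cite: BuzetChailloux2026, Prop. 4] -/
theorem qSign_mul_qSign_mul_qSign_bxor (x y : Fin n → Bool) :
    qSign x * qSign y * qSign (bxor x y) = (-1) ^ (hw x * hw y) * twist x y := by
  -- combine the three double products into one and apply the pairwise identity
  have step1 : qSign x * qSign y * qSign (bxor x y) =
      ∏ i, ∏ j, ((if i < j then bsgn (x i) (y j) else 1) * (if i < j then bsgn (x j) (y i) else 1)) := by
    simp only [qSign, ← prod_mul_distrib]
    refine prod_congr rfl fun i _ => prod_congr rfl fun j _ => ?_
    split_ifs with h
    · exact bsgn_pair (x i) (x j) (y i) (y j)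
    · simp
  -- swap the indices in the second factor
  have step2 : (∏ i, ∏ j, (if i < j then bsgn (x j) (y i) else 1 : ℝ)) =
      ∏ i, ∏ j, (if j < i then bsgn (x i) (y j) else 1 : ℝ) := by
    rw [prod_comm]
  -- trichotomy: the two strict halves make up the off-diagonal part
  have step3 : ∀ i j : Fin n, ((if i < j then bsgn (x i) (y j) else 1) *
      (if j < i then bsgn (x i) (y j) else 1) : ℝ) =
      bsgn (x i) (y j) * (if i = j then bsgn (x i) (y j) else 1) := by
    intro i j
    rcases lt_trichotomy i j with h | rfl | h
    · rw [if_pos h, if_neg (not_lt.2 h.le), if_neg h.ne, mul_one]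
    · rw [if_neg (lt_irrefl _), if_pos rfl, bsgn_mul_self, one_mul]
    · rw [if_neg (not_lt.2 h.le), if_pos h, if_neg h.ne', one_mul, mul_one]
  rw [step1]
  simp_rw [prod_mul_distrib]
  rw [step2, ← prod_mul_distrib]
  simp_rw [← prod_mul_distrib]
  simp_rw [step3]
  simp_rw [prod_mul_distrib]
  rw [prod_prod_bsgn]
  congr 1
  rw [twist_eq_prod_bsgn]
  refine prod_congr rfl fun i _ => ?_
  rw [prod_ite_eq]
  simp

/-- Prop. 4 solved for `(-1)^{Q(y)} (-1)^{Q(y ⊕ z)}`: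
`= (-1)^{Q(z)} (-1)^{|y||z|} (-1)^{y·z}`. [cite: BuzetChailloux2026, Prop. 4] -/
theorem qSign_mul_qSign_bxor (y z : Fin n → Bool) :
    qSign y * qSign (bxor y z) = qSign z * (-1) ^ (hw y * hw z) * twist y z := by
  have h := qSign_mul_qSign_mul_qSign_bxor y z
  have hz := qSign_mul_self z
  calc qSign y * qSign (bxor y z) = qSign z * qSign z * (qSign y * qSign (bxor y z)) := by
        rw [hz, one_mul]
    _ = qSign z * (qSign y * qSign z * qSign (bxor y z)) := by ring
    _ = qSign z * (-1) ^ (hw y * hw z) * twist y z := by rw [h]; ring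

/-! ### The bent functions `σ_odd`, `σ_even`, their transforms, and bentness for `n` odd -/

/-- The normalised transform `ĥ(x) = 2^{-n/2} ∑_y (-1)^{x·y} h(y)` (p. 7). [cite: BuzetChailloux2026, §1.3.1] -/
def hat (h : (Fin n → Bool) → ℝ) (x : Fin n → Bool) : ℝ :=
  (Real.sqrt ((2 : ℝ) ^ n))⁻¹ * ∑ y, twist x y * h y

/-- The autocorrelation `C_h(z) = ∑_y h(y) h(y ⊕ z)`. [cite: ODonnell2014, §1.4] -/
def autocorr (h : (Fin n → Bool) → ℝ) (z : Fin n → Bool) : ℝ := ∑ y, h y * h (bxor y z)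

/-- `√(2ⁿ) · √(2ⁿ) = 2ⁿ`. [folklore] -/
theorem sqrt_two_pow_mul_self (n : ℕ) : Real.sqrt ((2 : ℝ) ^ n) * Real.sqrt ((2 : ℝ) ^ n) = 2 ^ n :=
  Real.mul_self_sqrt (by positivity)

/-- **`ĥ(x)² = 2^{-n} ∑_z (-1)^{x·z} C_h(z)`** (Wiener–Khinchin over `𝔽₂ⁿ`).
[cite: ODonnell2014, §1.4] -/
theorem hat_sq (h : (Fin n → Bool) → ℝ) (x : Fin n → Bool) :
    hat h x ^ 2 = ((2 : ℝ) ^ n)⁻¹ * ∑ z, twist x z * autocorr h z := by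
  have hs : (Real.sqrt ((2 : ℝ) ^ n))⁻¹ ^ 2 = ((2 : ℝ) ^ n)⁻¹ := by
    rw [inv_pow, sq, sqrt_two_pow_mul_self]
  rw [hat, mul_pow, hs, sq, sum_mul_sum]
  congr 1
  -- reindex the inner sum by `y' = y ⊕ z`
  have inner : ∀ y : Fin n → Bool, ∑ y', twist x y * h y * (twist x y' * h y') =
      ∑ z, twist x z * (h y * h (bxor y z)) := by
    intro y
    rw [← Equiv.sum_comp (bxorPerm y)]
    refine sum_congr rfl fun z _ => ?_
    rw [bxorPerm_apply, twist_bxor_right]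
    have := twist_mul_self x y
    linear_combination (h y * twist x z * h (bxor y z)) * this
  rw [sum_congr rfl fun y _ => inner y, sum_comm]
  refine sum_congr rfl fun z _ => ?_
  rw [autocorr, mul_sum]

/-- If the autocorrelation of `h` is `2ⁿ δ₀`, then `ĥ(x)² = 1` for all `x` (`h` is bent, up to
the normalisation `√2`). [cite: ODonnell2014, §1.4] -/
theorem hat_sq_eq_one_of_autocorr (h : (Fin n → Bool) → ℝ)
    (hC : ∀ z, autocorr h z = if z = zeroVec then (2 : ℝ) ^ n else 0) (x : Fin n → Bool) :
    hat h x ^ 2 = 1 := by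
  rw [hat_sq]
  simp_rw [hC, mul_ite, mul_zero, Finset.sum_ite_eq' univ, if_pos (mem_univ _), twist_zeroVec_right,
    one_mul]
  exact inv_mul_cancel₀ (by positivity)

/-- **`σ_odd`** (Prop. 5): `σ(y) = √2 (-1)^{Q(y)}` for `|y|` odd, `0` otherwise.
[cite: BuzetChailloux2026, Prop. 5] -/
def sigmaOdd (y : Fin n → Bool) : ℝ := if Odd (hw y) then Real.sqrt 2 * qSign y else 0

/-- **`σ_even`** (Prop. 6): `σ(y) = √2 (-1)^{Q(y)}` for `|y|` even, `0` otherwise.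
[cite: BuzetChailloux2026, Prop. 6] -/
def sigmaEven (y : Fin n → Bool) : ℝ := if Even (hw y) then Real.sqrt 2 * qSign y else 0

/-- `√2 · √2 = 2`. [folklore] -/
theorem sqrt_two_mul_sqrt_two : Real.sqrt 2 * Real.sqrt 2 = 2 := Real.mul_self_sqrt zero_le_two

/-- `(-1)^{a b} = (-1)^b` for `a` odd, `= 1` for `a` even. [folklore] -/
theorem neg_one_pow_mul_of_odd {a : ℕ} (ha : Odd a) (b : ℕ) : ((-1 : ℝ)) ^ (a * b) = (-1) ^ b := by
  rw [pow_mul, ha.neg_one_pow]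

/-- `(-1)^{ab} = 1` for `a` even. [folklore] -/
theorem neg_one_pow_mul_of_even {a : ℕ} (ha : Even a) (b : ℕ) : ((-1 : ℝ)) ^ (a * b) = 1 := by
  rw [pow_mul, ha.neg_one_pow, one_pow]

/-- **Autocorrelation of `σ_odd` for `n` odd: `∑_y σ(y)σ(y ⊕ z) = 2ⁿ[z = 0]`.** By Prop. 4,
`(-1)^{Q(y)+Q(y⊕z)} = (-1)^{Q(z)+|y||z|+y·z}`; for `|y|` odd, `|y ⊕ z|` odd forces `|z|` even, so the
sum is `2 (-1)^{Q(z)+|z|} [|z| even] ∑_{|y| odd} (-1)^{y·z} = 2ⁿ[z = 0]` (`n` odd excludes `z = 1ⁿ`).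
[cite: BuzetChailloux2026, Lemma 1 and Prop. 4] -/
theorem autocorr_sigmaOdd (hn : Odd n) (z : Fin n → Bool) :
    autocorr sigmaOdd z = if z = zeroVec then (2 : ℝ) ^ n else 0 := by
  rcases Nat.even_or_odd (hw z) with hz | hz
  · -- `|z|` even: reduce to the parity-restricted character sum
    have hterm : ∀ y : Fin n → Bool, sigmaOdd y * sigmaOdd (bxor y z) =
        qSign z * (2 * (if Odd (hw y) then twist y z else 0)) := by
      intro y
      unfold sigmaOdd
      by_cases hy : Odd (hw y)
      · have hyz : Odd (hw (bxor y z)) := by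
          rw [← Nat.not_even_iff_odd, even_hw_bxor_iff, Nat.even_add, Nat.not_even_iff_odd] at *
          exact fun h => (Nat.not_even_iff_odd.2 hy) (h.2 hz)
        rw [if_pos hy, if_pos hyz, if_pos hy]
        have key := qSign_mul_qSign_bxor y z
        rw [neg_one_pow_mul_of_odd hy, hz.neg_one_pow, mul_one] at key
        calc Real.sqrt 2 * qSign y * (Real.sqrt 2 * qSign (bxor y z))
            = Real.sqrt 2 * Real.sqrt 2 * (qSign y * qSign (bxor y z)) := by ring
          _ = qSign z * (2 * twist y z) := by rw [sqrt_two_mul_sqrt_two, key]; ring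
      · rw [if_neg hy, if_neg hy, zero_mul, mul_zero, mul_zero]
    rw [autocorr, sum_congr rfl fun y _ => hterm y, ← mul_sum, ← mul_sum,
      two_mul_sum_odd_twist_of_even hn hz]
    split_ifs with h0
    · subst h0; simp
    · rw [mul_zero]
  · -- `|z|` odd: every term vanishes (`|y|`, `|y ⊕ z|` cannot both be odd), and `z ≠ 0`
    have hne : z ≠ zeroVec := by rintro rfl; rw [hw_zeroVec] at hz; exact Nat.not_odd_zero hz
    rw [if_neg hne, autocorr]
    refine sum_eq_zero fun y _ => ?_
    unfold sigmaOdd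
    by_cases hy : Odd (hw y)
    · have hyz : ¬ Odd (hw (bxor y z)) := by
        rw [Nat.not_odd_iff_even, even_hw_bxor_iff]
        exact hy.add_odd hz
      rw [if_neg hyz, mul_zero]
    · rw [if_neg hy, zero_mul]

/-- **Autocorrelation of `σ_even` for `n` odd: `∑_y σ(y)σ(y ⊕ z) = 2ⁿ[z = 0]`.**
[cite: BuzetChailloux2026, Lemma 2 and Prop. 4] -/
theorem autocorr_sigmaEven (hn : Odd n) (z : Fin n → Bool) :
    autocorr sigmaEven z = if z = zeroVec then (2 : ℝ) ^ n else 0 := by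
  rcases Nat.even_or_odd (hw z) with hz | hz
  · have hterm : ∀ y : Fin n → Bool, sigmaEven y * sigmaEven (bxor y z) =
        qSign z * (2 * (if Even (hw y) then twist y z else 0)) := by
      intro y
      unfold sigmaEven
      by_cases hy : Even (hw y)
      · have hyz : Even (hw (bxor y z)) := by
          rw [even_hw_bxor_iff]; exact hy.add hz
        rw [if_pos hy, if_pos hyz, if_pos hy]
        have key := qSign_mul_qSign_bxor y z
        rw [neg_one_pow_mul_of_even hy, mul_one] at key
        calc Real.sqrt 2 * qSign y * (Real.sqrt 2 * qSign (bxor y z))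
            = Real.sqrt 2 * Real.sqrt 2 * (qSign y * qSign (bxor y z)) := by ring
          _ = qSign z * (2 * twist y z) := by rw [sqrt_two_mul_sqrt_two, key]; ring
      · rw [if_neg hy, if_neg hy, zero_mul, mul_zero, mul_zero]
    rw [autocorr, sum_congr rfl fun y _ => hterm y, ← mul_sum, ← mul_sum,
      two_mul_sum_even_twist_of_even hn hz]
    split_ifs with h0
    · subst h0; simp
    · rw [mul_zero]
  · have hne : z ≠ zeroVec := by rintro rfl; rw [hw_zeroVec] at hz; exact Nat.not_odd_zero hz
    rw [if_neg hne, autocorr]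
    refine sum_eq_zero fun y _ => ?_
    unfold sigmaEven
    by_cases hy : Even (hw y)
    · have hyz : ¬ Even (hw (bxor y z)) := by
        rw [even_hw_bxor_iff, Nat.not_even_iff_odd]; exact hy.add_odd hz
      rw [if_neg hyz, mul_zero]
    · rw [if_neg hy, zero_mul]

/-- **Bentness (Lemma 1, "in particular"): for `n` odd, `σ̂_odd(x)² = 1` for every `x`.**
[cite: BuzetChailloux2026, Lemma 1] -/
theorem hat_sigmaOdd_sq (hn : Odd n) (x : Fin n → Bool) : hat sigmaOdd x ^ 2 = 1 :=
  hat_sq_eq_one_of_autocorr _ (autocorr_sigmaOdd hn) x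

/-- **Bentness (Lemma 2, "in particular"): for `n` odd, `σ̂_even(x)² = 1` for every `x`.**
[cite: BuzetChailloux2026, Lemma 2] -/
theorem hat_sigmaEven_sq (hn : Odd n) (x : Fin n → Bool) : hat sigmaEven x ^ 2 = 1 :=
  hat_sq_eq_one_of_autocorr _ (autocorr_sigmaEven hn) x

/-! ### Plancherel and the convolution formula for `ĥ` -/

/-- **Plancherel**: `∑_x ĥ(x)² = ∑_y h(y)²` (`= C_h(0)`). [cite: ODonnell2014, §1.4] -/
theorem sum_hat_sq (h : (Fin n → Bool) → ℝ) : ∑ x, hat h x ^ 2 = autocorr h zeroVec := by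
  simp_rw [hat_sq, mul_sum]
  rw [sum_comm]
  have : ∀ z : Fin n → Bool, ∑ x, ((2 : ℝ) ^ n)⁻¹ * (twist x z * autocorr h z) =
      ((2 : ℝ) ^ n)⁻¹ * autocorr h z * (if z = zeroVec then (2 : ℝ) ^ n else 0) := by
    intro z
    rw [← sum_twist_left z, mul_sum]
    exact sum_congr rfl fun x _ => by ring
  rw [sum_congr rfl fun z _ => this z]
  simp_rw [mul_ite, mul_zero, Finset.sum_ite_eq' univ, if_pos (mem_univ _)]
  field_simp

/-- For a `±1`-valued `h`, `C_h(0) = ∑_y h(y)² = 2ⁿ`. [cite: ODonnell2014, §1.4] -/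
theorem autocorr_zeroVec_of_sq (h : (Fin n → Bool) → ℝ) (hh : ∀ y, h y ^ 2 = 1) :
    autocorr h zeroVec = (2 : ℝ) ^ n := by
  rw [autocorr]
  simp_rw [bxor_zeroVec, ← sq, hh]
  simp

/-- **Parseval for a `±1`-valued function: `∑_x ĥ(x)² = 2ⁿ`.** [cite: BuzetChailloux2026, Prop. 1 (proof)] -/
theorem sum_hat_sq_of_sq (h : (Fin n → Bool) → ℝ) (hh : ∀ y, h y ^ 2 = 1) :
    ∑ x, hat h x ^ 2 = (2 : ℝ) ^ n := by
  rw [sum_hat_sq, autocorr_zeroVec_of_sq h hh]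

/-- **The convolution formula**: `∑_x â(x) b̂(x) σ̂(x) = 2^{-n/2} ∑_{r,s} a(r) b(s) σ(r ⊕ s)`.
[cite: BuzetChailloux2026, Prop. 1 (proof)] -/
theorem sum_hat_mul_hat_mul_hat (a b σ : (Fin n → Bool) → ℝ) :
    ∑ x, hat a x * hat b x * hat σ x =
      (Real.sqrt ((2 : ℝ) ^ n))⁻¹ * ∑ r, ∑ s, a r * b s * σ (bxor r s) := by
  set k : ℝ := (Real.sqrt ((2 : ℝ) ^ n))⁻¹ with hk
  have hk2 : k * k * (2 : ℝ) ^ n = 1 := by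
    rw [hk, ← mul_inv, sqrt_two_pow_mul_self, inv_mul_cancel₀ (by positivity)]
  -- expand the three transforms and exchange the order of summation
  have expand : ∀ x : Fin n → Bool, hat a x * hat b x * hat σ x =
      k * k * k * ∑ r, ∑ s, ∑ t, a r * b s * σ t * twist x (bxor (bxor r s) t) := by
    intro x
    simp only [hat, ← hk]
    rw [show k * (∑ y, twist x y * a y) * (k * ∑ y, twist x y * b y) * (k * ∑ y, twist x y * σ y)
        = k * k * k * ((∑ y, twist x y * a y) * (∑ y, twist x y * b y) * (∑ y, twist x y * σ y)) by ring]
    congr 1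
    rw [sum_mul_sum, sum_mul]
    refine sum_congr rfl fun r _ => ?_
    rw [sum_mul]
    refine sum_congr rfl fun s _ => ?_
    rw [mul_sum]
    refine sum_congr rfl fun t _ => ?_
    rw [twist_bxor_right, twist_bxor_right]
    ring
  -- for fixed `r`: exchange the sums and collapse `∑_x (-1)^{x·(r⊕s⊕t)} = 2ⁿ[t = r ⊕ s]`
  have inner : ∀ r : Fin n → Bool, ∑ x, ∑ s, ∑ t, a r * b s * σ t * twist x (bxor (bxor r s) t) =
      2 ^ n * ∑ s, a r * b s * σ (bxor r s) := by
    intro r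
    rw [sum_comm, mul_sum]
    refine sum_congr rfl fun s _ => ?_
    rw [sum_comm]
    have hx : ∀ t : Fin n → Bool, ∑ x, a r * b s * σ t * twist x (bxor (bxor r s) t) =
        a r * b s * σ t * (if bxor (bxor r s) t = zeroVec then (2 : ℝ) ^ n else 0) := by
      intro t; rw [← sum_twist_left, mul_sum]
    rw [sum_congr rfl fun t _ => hx t]
    simp_rw [bxor_eq_zeroVec_iff, mul_ite, mul_zero]
    rw [Finset.sum_ite_eq univ (bxor r s), if_pos (mem_univ _)]
    ring
  simp_rw [expand]
  rw [← mul_sum, sum_comm, sum_congr rfl fun r _ => inner r, ← mul_sum]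
  linear_combination (k * ∑ r, ∑ s, a r * b s * σ (bxor r s)) * hk2

/-! ### The circuit of §3.1: oracle, diagonal, amplitudes, acceptance probability -/

/-- The phase oracle `O_{f,g}` on `n + 1` qubits: `|0 x⟩ ↦ f(x)|0 x⟩`, `|1 x⟩ ↦ g(x)|1 x⟩` (the
truth tables `z_{0x} = f(x)`, `z_{1x} = g(x)`, p. 10). [cite: BuzetChailloux2026, §1.3.4 and §3.1] -/
def oracle (f g : (Fin n → Bool) → ℝ) : Bool → (Fin n → Bool) → ℝ := fun b => cond b g f

/-- `o₀ = f`. [folklore] -/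
@[simp] theorem oracle_false (f g : (Fin n → Bool) → ℝ) : oracle f g false = f := rfl
/-- `o₁ = g`. [folklore] -/
@[simp] theorem oracle_true (f g : (Fin n → Bool) → ℝ) : oracle f g true = g := rfl

/-- **The output amplitude of the IQP circuit** `H^{⊗(n+1)} D O H^{⊗(n+1)}` on `|0^{n+1}⟩` at the
basis state `|b x⟩`, for the diagonal `D = ∑ ρ_b(x)|b x⟩⟨b x|` and the diagonal oracle
`O = ∑ o_b(x)|b x⟩⟨b x|`: `2^{-(n+1)} ∑_{b',x'} (-1)^{bb'} (-1)^{x·x'} ρ_{b'}(x') o_{b'}(x')`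
(two Hadamard layers, each with matrix elements `2^{-(n+1)/2}(-1)^{bb'+x·x'}`, around the diagonal
phases). [cite: BuzetChailloux2026, §3.1 and proof of Prop. 1] -/
def iqpAmplitude (ρ o : Bool → (Fin n → Bool) → ℝ) (b : Bool) (x : Fin n → Bool) : ℝ :=
  ((2 : ℝ) ^ (n + 1))⁻¹ * ∑ b' : Bool, ∑ x' : Fin n → Bool, bsgn b b' * twist x x' * (ρ b' x' * o b' x')

/-- **The acceptance probability** of the circuit with accepting set `F ⊆ {0,1} × {0,1}ⁿ` (Born
rule; all amplitudes are real). [cite: BuzetChailloux2026, §3.1] -/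
def iqpAccProb (ρ o : Bool → (Fin n → Bool) → ℝ) (F : Finset (Bool × (Fin n → Bool))) : ℝ :=
  ∑ bx ∈ F, iqpAmplitude ρ o bx.1 bx.2 ^ 2

/-- The accepting set `F = {0} × T ∪ {1} × T̄` of Prop. 1. [cite: BuzetChailloux2026, Prop. 1 (proof)] -/
def accSet (T : Finset (Fin n → Bool)) : Finset (Bool × (Fin n → Bool)) :=
  univ.filter fun bx => (bx.1 = false ∧ bx.2 ∈ T) ∨ (bx.1 = true ∧ bx.2 ∉ T)

/-- The accepting set of Prop. 1 for the bent function `σ`: `T = {x : σ̂(x) = 1}`.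
[cite: BuzetChailloux2026, Prop. 1 (proof)] -/
def bentSet (σ : (Fin n → Bool) → ℝ) : Finset (Fin n → Bool) := univ.filter fun x => hat σ x = 1

/-- Membership in `T = {x : σ̂(x) = 1}`. [cite: BuzetChailloux2026, Prop. 1 (proof)] -/
@[simp] theorem mem_bentSet {σ : (Fin n → Bool) → ℝ} {x : Fin n → Bool} :
    x ∈ bentSet σ ↔ hat σ x = 1 := by
  simp [bentSet]

/-- `(-1)^{[b][0]} = 1`. [folklore] -/
@[simp] theorem bsgn_false_right (b : Bool) : bsgn b false = 1 := by cases b <;> rfl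
/-- `(-1)^{[0][1]} = 1`. [folklore] -/
@[simp] theorem bsgn_false_true : bsgn false true = 1 := rfl
/-- `(-1)^{[1][1]} = -1`. [folklore] -/
@[simp] theorem bsgn_true_true : bsgn true true = -1 := rfl

/-- `√(2ⁿ) ĥ(x) = ∑_y (-1)^{x·y} h(y)` (the unnormalised transform). [folklore] -/
theorem sqrt_mul_hat (h : (Fin n → Bool) → ℝ) (x : Fin n → Bool) :
    Real.sqrt ((2 : ℝ) ^ n) * hat h x = ∑ y, twist x y * h y := by
  rw [hat, ← mul_assoc, mul_inv_cancel₀ (Real.sqrt_ne_zero'.2 (by positivity)), one_mul]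

/-- The amplitudes in terms of the transforms of `a = ρ₀o₀`, `b = ρ₁o₁`:
`amp(0,x) = 2^{-(n+2)/2}(â(x) + b̂(x))`, `amp(1,x) = 2^{-(n+2)/2}(â(x) - b̂(x))`, written with
`bsgn b 1 = ∓1`. [cite: BuzetChailloux2026, Prop. 1 (proof)] -/
theorem iqpAmplitude_eq (ρ o : Bool → (Fin n → Bool) → ℝ) (b : Bool) (x : Fin n → Bool) :
    iqpAmplitude ρ o b x = ((2 : ℝ) ^ (n + 1))⁻¹ * Real.sqrt ((2 : ℝ) ^ n) *
      (hat (fun y => ρ false y * o false y) x + bsgn b true * hat (fun y => ρ true y * o true y) x) := by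
  rw [iqpAmplitude, Fintype.sum_bool, mul_assoc (((2 : ℝ) ^ (n + 1))⁻¹), mul_add (Real.sqrt _),
    sqrt_mul_hat, mul_left_comm (Real.sqrt _), sqrt_mul_hat]
  congr 1
  rw [add_comm]
  congr 1
  · exact sum_congr rfl fun y _ => by rw [bsgn_false_right, one_mul]
  · rw [mul_sum]
    exact sum_congr rfl fun y _ => by ring

/-- Unfolding the sum over the accepting set `{0} × T ∪ {1} × T̄`.
[cite: BuzetChailloux2026, Prop. 1 (proof)] -/
theorem iqpAccProb_accSet (ρ o : Bool → (Fin n → Bool) → ℝ) (T : Finset (Fin n → Bool)) :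
    iqpAccProb ρ o (accSet T) =
      ∑ x, ((if x ∈ T then iqpAmplitude ρ o false x ^ 2 else 0) +
        (if x ∈ T then 0 else iqpAmplitude ρ o true x ^ 2)) := by
  rw [iqpAccProb, accSet, sum_filter, Fintype.sum_prod_type, Fintype.sum_bool, ← sum_add_distrib]
  refine sum_congr rfl fun x _ => ?_
  by_cases hx : x ∈ T <;> simp [hx, add_comm]

/-- `√(2^{3n+2}) = 2^{n+1} √(2ⁿ)`. [folklore] -/
theorem sqrt_two_pow_three_mul_add_two (n : ℕ) :
    Real.sqrt ((2 : ℝ) ^ (3 * n + 2)) = 2 ^ (n + 1) * Real.sqrt ((2 : ℝ) ^ n) := by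
  rw [show (2 : ℝ) ^ (3 * n + 2) = (2 ^ (n + 1)) ^ 2 * 2 ^ n by ring, Real.sqrt_mul (by positivity),
    Real.sqrt_sq (by positivity)]

/-- **Proposition 1 (the acceptance probability of the circuit of §3.1).** If `a = ρ₀ o₀` and
`b = ρ₁ o₁` are `±1`-valued and `σ` is bent (`σ̂(x)² = 1` for all `x`), then with
`T = {x : σ̂(x) = 1}` and `F = {0} × T ∪ {1} × T̄`,
`P_acc = 1/2 + √(1/2^{3n+2}) ∑_{x,y} a(x) b(y) σ(x ⊕ y)`. Proof as printed: `amp(0,x) = c(â+b̂)`,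
`amp(1,x) = c(â-b̂)`, `σ̂ = (-1)^{1_T̄}`, Parseval, and the convolution formula.
[cite: BuzetChailloux2026, Prop. 1] -/
theorem iqpAccProb_accSet_eq (ρ o : Bool → (Fin n → Bool) → ℝ)
    (ha : ∀ y, (ρ false y * o false y) ^ 2 = 1) (hb : ∀ y, (ρ true y * o true y) ^ 2 = 1)
    (σ : (Fin n → Bool) → ℝ) (hσ : ∀ x, hat σ x ^ 2 = 1) :
    iqpAccProb ρ o (accSet (bentSet σ)) =
      1 / 2 + (Real.sqrt ((2 : ℝ) ^ (3 * n + 2)))⁻¹ *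
        ∑ x, ∑ y, ρ false x * o false x * (ρ true y * o true y) * σ (bxor x y) := by
  set c : ℝ := ((2 : ℝ) ^ (n + 1))⁻¹ * Real.sqrt ((2 : ℝ) ^ n) with hc
  -- the sign `s(x) = ±1` of the accepting set is `σ̂(x)`
  have hsign : ∀ x, hat σ x = 1 ∨ hat σ x = -1 := fun x => sq_eq_one_iff.1 (hσ x)
  -- pointwise: the two branches combine to `c² (â² + b̂² + 2 σ̂ â b̂)`
  have hpt : ∀ x, ((if x ∈ bentSet σ then iqpAmplitude ρ o false x ^ 2 else 0) +
      (if x ∈ bentSet σ then 0 else iqpAmplitude ρ o true x ^ 2)) =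
      c ^ 2 * (hat (fun y => ρ false y * o false y) x ^ 2 + hat (fun y => ρ true y * o true y) x ^ 2 +
        2 * (hat (fun y => ρ false y * o false y) x * hat (fun y => ρ true y * o true y) x * hat σ x)) := by
    intro x
    have h0 := iqpAmplitude_eq ρ o false x
    have h1 := iqpAmplitude_eq ρ o true x
    rw [bsgn_false_true, one_mul, ← hc] at h0
    rw [bsgn_true_true, neg_one_mul, ← hc] at h1
    by_cases hx : x ∈ bentSet σ
    · have hs : hat σ x = 1 := mem_bentSet.1 hx
      rw [if_pos hx, if_pos hx, h0, hs]; ring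
    · have hs : hat σ x = -1 := by
        rcases hsign x with h | h
        · exact absurd (mem_bentSet.2 h) hx
        · exact h
      rw [if_neg hx, if_neg hx, h1, hs]; ring
  rw [iqpAccProb_accSet, sum_congr rfl fun x _ => hpt x, ← mul_sum, sum_add_distrib, sum_add_distrib,
    ← mul_sum, sum_hat_sq_of_sq _ ha, sum_hat_sq_of_sq _ hb, sum_hat_mul_hat_mul_hat,
    sqrt_two_pow_three_mul_add_two]
  -- constants: `c² (2·2ⁿ) = 1/2` and `c² · 2 · 2^{-n/2} = 2^{-(n+1)} 2^{-n/2}`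
  have hsq : Real.sqrt ((2 : ℝ) ^ n) ^ 2 = 2 ^ n := by rw [sq, sqrt_two_pow_mul_self]
  have hsne : Real.sqrt ((2 : ℝ) ^ n) ≠ 0 := Real.sqrt_ne_zero'.2 (by positivity)
  have h2ne : (2 : ℝ) ^ (n + 1) ≠ 0 := by positivity
  rw [hc]
  field_simp
  rw [hsq]
  ring

/-! ### The two circuits of §3.4 (`n` odd) and Theorem 1 -/

/-- The diagonal of Prop. 5: `ρ₀ = ρ₁ = (-1)^Q` (a `CZ` on every pair of the `n` oracle-address
qubits, on both branches of the block qubit). [cite: BuzetChailloux2026, Prop. 5] -/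
def rhoOdd : Bool → (Fin n → Bool) → ℝ := fun _ x => qSign x

/-- The diagonal of Prop. 6: `ρ₀ = (-1)^Q`, `ρ₁ = (-1)^{Q + |·|}` (additionally a `Z` on every
address qubit, controlled on the block qubit). [cite: BuzetChailloux2026, Prop. 6] -/
def rhoEven : Bool → (Fin n → Bool) → ℝ := fun b x => cond b (qSign x * (-1) ^ hw x) (qSign x)

/-- Acceptance probability of the circuit of Prop. 5 (diagonal `rhoOdd`, accepting set from
`σ_odd`). [cite: BuzetChailloux2026, Prop. 5] -/
def accProbOdd (f g : (Fin n → Bool) → ℝ) : ℝ :=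
  iqpAccProb rhoOdd (oracle f g) (accSet (bentSet sigmaOdd))

/-- Acceptance probability of the circuit of Prop. 6 (diagonal `rhoEven`, accepting set from
`σ_even`). [cite: BuzetChailloux2026, Prop. 6] -/
def accProbEven (f g : (Fin n → Bool) → ℝ) : ℝ :=
  iqpAccProb rhoEven (oracle f g) (accSet (bentSet sigmaEven))

/-- **The IQP computation of Prop. 7 / Thm. 1**: flip a fair coin and run the circuit of Prop. 5
or of Prop. 6; its acceptance probability is the average. [cite: BuzetChailloux2026, Prop. 7] -/
def thm1AccProb (f g : (Fin n → Bool) → ℝ) : ℝ := (accProbOdd f g + accProbEven f g) / 2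

/-- The signed 2-forrelation `Φ(f,g) = 2^{-3n/2} ∑_{x,y} f(x) (-1)^{x·y} g(y)` of two real
(`±1`-valued) functions; for Boolean data read through `signOf` this is the tree's `forrelation`
(`phi_signOf`). [cite: BuzetChailloux2026, §1.1] [cite: AaronsonAmbainis2018, §1.1.1] -/
def phi (f g : (Fin n → Bool) → ℝ) : ℝ :=
  (Real.sqrt ((2 : ℝ) ^ (3 * n)))⁻¹ * ∑ x, ∑ y, f x * twist x y * g y

/-- `phi (signOf ∘ f) (signOf ∘ g) = forrelation f g` (by `rfl` up to unfolding).
[cite: AaronsonAmbainis2018, §1.1.1] -/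
theorem phi_signOf (f g : (Fin n → Bool) → Bool) :
    phi (fun x => signOf (f x)) (fun y => signOf (g y)) = forrelation f g := rfl

/-- `(-1)^{|x||y|} = 1` when `|x ⊕ y|` is odd (one of `|x|`, `|y|` is even).
[cite: BuzetChailloux2026, Prop. 5 (proof)] -/
theorem neg_one_pow_hw_mul_hw_of_odd {x y : Fin n → Bool} (h : Odd (hw (bxor x y))) :
    ((-1 : ℝ)) ^ (hw x * hw y) = 1 := by
  rw [← Nat.not_even_iff_odd, even_hw_bxor_iff, Nat.even_add] at h
  rcases Nat.even_or_odd (hw x) with hx | hx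
  · exact neg_one_pow_mul_of_even hx _
  · rw [neg_one_pow_mul_of_odd hx]
    have hy : Even (hw y) := by
      by_contra hy
      exact h ⟨fun hxe => absurd hxe (Nat.not_even_iff_odd.2 hx), fun hye => absurd hye hy⟩
    exact hy.neg_one_pow

/-- `(-1)^{|y|} (-1)^{|x||y|} = 1` when `|x ⊕ y|` is even (`|x| ≡ |y|`, so `|x||y| + |y| ≡ |y|² + |y| ≡ 0`).
[cite: BuzetChailloux2026, Prop. 6 (proof)] -/
theorem neg_one_pow_hw_mul_of_even {x y : Fin n → Bool} (h : Even (hw (bxor x y))) :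
    ((-1 : ℝ)) ^ hw y * (-1) ^ (hw x * hw y) = 1 := by
  rw [even_hw_bxor_iff, Nat.even_add] at h
  rcases Nat.even_or_odd (hw y) with hy | hy
  · rw [hy.neg_one_pow, neg_one_pow_mul_of_even (h.2 hy), one_mul]
  · have hx : Odd (hw x) := by
      rw [← Nat.not_even_iff_odd]; exact fun hx => (Nat.not_even_iff_odd.2 hy) (h.1 hx)
    rw [hy.neg_one_pow, neg_one_pow_mul_of_odd hx, hy.neg_one_pow]; norm_num

/-- **Proposition 5** (`n` odd): the circuit with `ρ₀ = ρ₁ = (-1)^Q` and accepting set from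
`σ_odd` accepts with probability `1/2 + Φ_odd(f,g)/√2 = 1/2 + √(1/2^{3n+1}) ∑_{|x⊕y| odd} f(x)g(y)(-1)^{x·y}`
(here written with the factor `√2/√(2^{3n+2})`). [cite: BuzetChailloux2026, Prop. 5] -/
theorem accProbOdd_eq (hn : Odd n) (f g : (Fin n → Bool) → ℝ) (hf : ∀ x, f x ^ 2 = 1)
    (hg : ∀ x, g x ^ 2 = 1) :
    accProbOdd f g = 1 / 2 + (Real.sqrt ((2 : ℝ) ^ (3 * n + 2)))⁻¹ * (Real.sqrt 2 *
      ∑ x, ∑ y, if Odd (hw (bxor x y)) then f x * twist x y * g y else 0) := by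
  have ha : ∀ y, (rhoOdd false y * oracle f g false y) ^ 2 = 1 := fun y => by
    simp only [rhoOdd, oracle_false, mul_pow, hf]; rw [sq, qSign_mul_self, one_mul]
  have hb : ∀ y, (rhoOdd true y * oracle f g true y) ^ 2 = 1 := fun y => by
    simp only [rhoOdd, oracle_true, mul_pow, hg]; rw [sq, qSign_mul_self, one_mul]
  rw [accProbOdd, iqpAccProb_accSet_eq _ _ ha hb sigmaOdd (hat_sigmaOdd_sq hn)]
  congr 2
  simp only [rhoOdd, oracle_false, oracle_true, mul_sum]
  refine sum_congr rfl fun x _ => sum_congr rfl fun y _ => ?_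
  unfold sigmaOdd
  split_ifs with hxy
  · have key := qSign_mul_qSign_mul_qSign_bxor x y
    rw [neg_one_pow_hw_mul_hw_of_odd hxy, one_mul] at key
    linear_combination (Real.sqrt 2 * f x * g y) * key
  · rw [mul_zero, mul_zero]

/-- **Proposition 6** (`n` odd): the circuit with `ρ₀ = (-1)^Q`, `ρ₁ = (-1)^{Q+|·|}` and accepting
set from `σ_even` accepts with probability
`1/2 + Φ_even(f,g)/√2 = 1/2 + √(1/2^{3n+1}) ∑_{|x⊕y| even} f(x)g(y)(-1)^{x·y}`.
[cite: BuzetChailloux2026, Prop. 6] -/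
theorem accProbEven_eq (hn : Odd n) (f g : (Fin n → Bool) → ℝ) (hf : ∀ x, f x ^ 2 = 1)
    (hg : ∀ x, g x ^ 2 = 1) :
    accProbEven f g = 1 / 2 + (Real.sqrt ((2 : ℝ) ^ (3 * n + 2)))⁻¹ * (Real.sqrt 2 *
      ∑ x, ∑ y, if Even (hw (bxor x y)) then f x * twist x y * g y else 0) := by
  have ha : ∀ y, (rhoEven false y * oracle f g false y) ^ 2 = 1 := fun y => by
    simp only [rhoEven, cond_false, oracle_false, mul_pow, hf]; rw [sq, qSign_mul_self, one_mul]
  have hb : ∀ y, (rhoEven true y * oracle f g true y) ^ 2 = 1 := fun y => by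
    have h1 : ((-1 : ℝ) ^ hw y) ^ 2 = 1 := by
      rw [← pow_mul, mul_comm, pow_mul, neg_one_sq, one_pow]
    simp only [rhoEven, cond_true, oracle_true, mul_pow, hg, h1, mul_one]
    rw [sq, qSign_mul_self]
  rw [accProbEven, iqpAccProb_accSet_eq _ _ ha hb sigmaEven (hat_sigmaEven_sq hn)]
  congr 2
  simp only [rhoEven, cond_false, cond_true, oracle_false, oracle_true, mul_sum]
  refine sum_congr rfl fun x _ => sum_congr rfl fun y _ => ?_
  unfold sigmaEven
  split_ifs with hxy
  · have key := qSign_mul_qSign_mul_qSign_bxor x y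
    have hpar := neg_one_pow_hw_mul_of_even hxy
    -- `qSign x f x (qSign y (-1)^{|y|} g y) √2 qSign(x⊕y) = √2 f g (-1)^{|y|} (-1)^{|x||y|} twist`
    have : qSign x * f x * (qSign y * (-1) ^ hw y * g y) * (Real.sqrt 2 * qSign (bxor x y)) =
        Real.sqrt 2 * f x * g y * ((-1) ^ hw y * ((-1) ^ (hw x * hw y) * twist x y)) := by
      rw [← key]; ring
    rw [this, ← mul_assoc ((-1 : ℝ) ^ hw y), hpar, one_mul]
    ring
  · rw [mul_zero, mul_zero]

/-- `√(2^{3n+2}) = 2 √(2^{3n})`. [folklore] -/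
theorem sqrt_two_pow_three_mul_add_two' (n : ℕ) :
    Real.sqrt ((2 : ℝ) ^ (3 * n + 2)) = 2 * Real.sqrt ((2 : ℝ) ^ (3 * n)) := by
  rw [show (2 : ℝ) ^ (3 * n + 2) = 2 ^ 2 * 2 ^ (3 * n) by ring, Real.sqrt_mul (by positivity),
    Real.sqrt_sq (by norm_num)]

/-- **Theorem 1 of Buzet–Chailloux for `n` odd (Prop. 7).** For `f, g : {0,1}ⁿ → {±1}` (`n` odd),
the IQP computation "flip a fair coin; run the single-query IQP circuit of Prop. 5 or of Prop. 6"
accepts with probability EXACTLY `1/2 + Φ(f,g)/(2√2)`, `Φ(f,g) = 2^{-3n/2} ∑_{x,y} f(x)(-1)^{x·y}g(y)`.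
[cite: BuzetChailloux2026, Thm. 1 and Prop. 7] -/
theorem BuzetChailloux2026_thm1_odd (hn : Odd n) (f g : (Fin n → Bool) → ℝ)
    (hf : ∀ x, f x ^ 2 = 1) (hg : ∀ x, g x ^ 2 = 1) :
    thm1AccProb f g = 1 / 2 + phi f g / (2 * Real.sqrt 2) := by
  have hsum : (∑ x, ∑ y, if Odd (hw (bxor x y)) then f x * twist x y * g y else 0) +
      (∑ x, ∑ y, if Even (hw (bxor x y)) then f x * twist x y * g y else 0) =
      ∑ x : Fin n → Bool, ∑ y : Fin n → Bool, f x * twist x y * g y := by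
    rw [← sum_add_distrib]
    refine sum_congr rfl fun x _ => ?_
    rw [← sum_add_distrib]
    refine sum_congr rfl fun y _ => ?_
    rcases Nat.even_or_odd (hw (bxor x y)) with h | h
    · rw [if_neg (Nat.not_odd_iff_even.2 h), if_pos h, zero_add]
    · rw [if_pos h, if_neg (Nat.not_even_iff_odd.2 h), add_zero]
  rw [thm1AccProb, accProbOdd_eq hn f g hf hg, accProbEven_eq hn f g hf hg, phi,
    sqrt_two_pow_three_mul_add_two']
  rw [show ∀ (A B C : ℝ), (1 / 2 + A * (B * C) + (1 / 2 + A * (B * (∑ x, ∑ y,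
      if Even (hw (bxor x y)) then f x * twist x y * g y else 0)))) / 2 =
      1 / 2 + A * B * (C + ∑ x, ∑ y, if Even (hw (bxor x y)) then f x * twist x y * g y else 0) / 2
      from fun A B C => by ring, hsum]
  have hsne : Real.sqrt ((2 : ℝ) ^ (3 * n)) ≠ 0 := Real.sqrt_ne_zero'.2 (by positivity)
  have h2 : Real.sqrt 2 ≠ 0 := Real.sqrt_ne_zero'.2 (by norm_num)
  field_simp
  linear_combination (∑ x : Fin n → Bool, ∑ y : Fin n → Bool, f x * twist x y * g y) *
    sqrt_two_mul_sqrt_two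

/-- `signOf b = ±1`. [folklore] -/
theorem signOf_sq (b : Bool) : signOf b ^ 2 = 1 := by cases b <;> simp [signOf]

/-- **Theorem 1 (`n` odd), Boolean-oracle form over the tree's `forrelation`:** for
`f g : {0,1}ⁿ → {0,1}` read in `{±1}` through `signOf`, the fair-coin mixture of the two
single-query IQP circuits accepts with probability `1/2 + Φ_{f,g}/(2√2)`.
[cite: BuzetChailloux2026, Thm. 1] [cite: AaronsonAmbainis2018, §1.1.1] -/
theorem BuzetChailloux2026_thm1_odd_forrelation (hn : Odd n) (f g : (Fin n → Bool) → Bool) :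
    thm1AccProb (fun x => signOf (f x)) (fun y => signOf (g y)) =
      1 / 2 + forrelation f g / (2 * Real.sqrt 2) := by
  rw [← phi_signOf]
  exact BuzetChailloux2026_thm1_odd hn _ _ (fun x => signOf_sq (f x)) (fun y => signOf_sq (g y))

/-! ### The even case (Prop. 8): padding by a dummy variable -/

/-- **Def. 6 (padding)**: `f̄(x₁, …, x_{n+1}) = f(x₁, …, xₙ)` — a dummy last variable that the
function ignores (its oracle `O_{f̄,ḡ}` is one call to `O_{f,g}` on the first `n` address qubits).
[cite: BuzetChailloux2026, Def. 6] -/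
def pad (f : (Fin n → Bool) → ℝ) : (Fin (n + 1) → Bool) → ℝ := fun x => f fun j => x (Fin.castSucc j)

/-- Bit vectors of length `n + 1` are (first `n` bits, last bit) (`Fin.snoc`). [folklore] -/
def snocEquiv1 (n : ℕ) : (Fin n → Bool) × Bool ≃ (Fin (n + 1) → Bool) where
  toFun p := Fin.snoc p.1 p.2
  invFun x := (fun j => x (Fin.castSucc j), x (Fin.last n))
  left_inv p := by
    obtain ⟨y, b⟩ := p
    simp only [Fin.snoc_castSucc, Fin.snoc_last]
  right_inv x := Fin.snoc_init_self x

/-- `f̄(x, a) = f(x)`: the padded function ignores the last bit. [folklore] -/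
@[simp] theorem pad_snoc (f : (Fin n → Bool) → ℝ) (x : Fin n → Bool) (a : Bool) :
    pad f (Fin.snoc x a) = f x := by
  simp [pad, Fin.snoc_castSucc]

/-- `∑_{a,b ∈ {0,1}} (-1)^{ab} = 2`. [cite: BuzetChailloux2026, Prop. 8 (proof)] -/
theorem sum_sum_signOf_and : ∑ a : Bool, ∑ b : Bool, signOf (a && b) = 2 := by
  simp [signOf]; norm_num

/-- **Prop. 8's computation: `Φ(f̄, ḡ) = Φ(f, g)/√2`.** Splitting `x = (x', a)`, `y = (y', b)`:
`(-1)^{x·y} = (-1)^{x'·y'} (-1)^{ab}`, `∑_{a,b} (-1)^{ab} = 2`, and `2/2^{3(n+1)/2} = 2^{-3n/2}/√2`.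
[cite: BuzetChailloux2026, Prop. 8] -/
theorem phi_pad (f g : (Fin n → Bool) → ℝ) : phi (pad f) (pad g) = phi f g / Real.sqrt 2 := by
  have hsum : ∑ x : Fin (n + 1) → Bool, ∑ y : Fin (n + 1) → Bool, pad f x * twist x y * pad g y =
      2 * ∑ x : Fin n → Bool, ∑ y : Fin n → Bool, f x * twist x y * g y := by
    rw [← (snocEquiv1 n).sum_comp]
    simp_rw [← (snocEquiv1 n).sum_comp (fun y => pad f _ * twist _ y * pad g y)]
    simp only [snocEquiv1, Equiv.coe_fn_mk, Fintype.sum_prod_type, pad_snoc, twist_snoc]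
    rw [mul_sum]
    refine sum_congr rfl fun x _ => ?_
    rw [sum_comm, mul_sum]
    refine sum_congr rfl fun y _ => ?_
    have h2 := sum_sum_signOf_and
    rw [show ∑ a : Bool, ∑ b : Bool, f x * (twist x y * signOf (a && b)) * g y =
        f x * twist x y * g y * ∑ a : Bool, ∑ b : Bool, signOf (a && b) by
      rw [mul_sum]; refine sum_congr rfl fun a _ => ?_; rw [mul_sum]
      exact sum_congr rfl fun b _ => by ring, h2]
    ring
  have hsq : Real.sqrt ((2 : ℝ) ^ (3 * (n + 1))) = Real.sqrt ((2 : ℝ) ^ (3 * n)) * (2 * Real.sqrt 2) := by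
    rw [show (2 : ℝ) ^ (3 * (n + 1)) = 2 ^ (3 * n) * (2 ^ 2 * 2) by ring,
      Real.sqrt_mul (by positivity), Real.sqrt_mul (by positivity), Real.sqrt_sq (by norm_num)]
  rw [phi, phi, hsum, hsq]
  have h1 : Real.sqrt ((2 : ℝ) ^ (3 * n)) ≠ 0 := Real.sqrt_ne_zero'.2 (by positivity)
  have h2 : Real.sqrt 2 ≠ 0 := Real.sqrt_ne_zero'.2 (by norm_num)
  field_simp

/-- Padding preserves `±1`-valuedness. [folklore] -/
theorem pad_sq {f : (Fin n → Bool) → ℝ} (hf : ∀ x, f x ^ 2 = 1) (x : Fin (n + 1) → Bool) :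
    pad f x ^ 2 = 1 := hf _

/-- **Theorem 1 of Buzet–Chailloux for `n` even (Prop. 8).** For `f, g : {0,1}ⁿ → {±1}` with `n`
even, running the `n + 1`-address-qubit IQP computation of the odd case on the padded functions
`f̄, ḡ` (one call to `O_{f,g}`) accepts with probability EXACTLY `1/2 + Φ(f,g)/4`.
[cite: BuzetChailloux2026, Thm. 1 and Prop. 8] -/
theorem BuzetChailloux2026_thm1_even (hn : Even n) (f g : (Fin n → Bool) → ℝ)
    (hf : ∀ x, f x ^ 2 = 1) (hg : ∀ x, g x ^ 2 = 1) :
    thm1AccProb (pad f) (pad g) = 1 / 2 + phi f g / 4 := by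
  rw [BuzetChailloux2026_thm1_odd hn.add_one _ _ (pad_sq hf) (pad_sq hg), phi_pad]
  have h2 : Real.sqrt 2 ≠ 0 := Real.sqrt_ne_zero'.2 (by norm_num)
  field_simp
  linear_combination (-2 * phi f g) * Real.sq_sqrt (zero_le_two (α := ℝ))

/-- **Theorem 1 (`n` even), Boolean-oracle form**: `P_acc = 1/2 + Φ_{f,g}/4` for the padded circuit.
[cite: BuzetChailloux2026, Thm. 1] [cite: AaronsonAmbainis2018, §1.1.1] -/
theorem BuzetChailloux2026_thm1_even_forrelation (hn : Even n) (f g : (Fin n → Bool) → Bool) :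
    thm1AccProb (pad fun x => signOf (f x)) (pad fun y => signOf (g y)) =
      1 / 2 + forrelation f g / 4 := by
  rw [← phi_signOf]
  exact BuzetChailloux2026_thm1_even hn _ _ (fun x => signOf_sq (f x)) (fun y => signOf_sq (g y))

/-! ### Theorem 2: two queries, bias `Φ²` -/

/-- **The two-query IQP computation of Thm. 2**: run the computation of Thm. 1 twice
independently and accept iff both runs give the same outcome; its acceptance probability is
`P² + (1 - P)²`. [cite: BuzetChailloux2026, Thm. 2 (proof)] -/
def thm2AccProb (f g : (Fin n → Bool) → ℝ) : ℝ := thm1AccProb f g ^ 2 + (1 - thm1AccProb f g) ^ 2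

/-- **Theorem 2 of Buzet–Chailloux, `n` odd**: `P_acc = 1/2 + Φ(f,g)²/4`.
[cite: BuzetChailloux2026, Thm. 2] -/
theorem BuzetChailloux2026_thm2_odd (hn : Odd n) (f g : (Fin n → Bool) → ℝ)
    (hf : ∀ x, f x ^ 2 = 1) (hg : ∀ x, g x ^ 2 = 1) :
    thm2AccProb f g = 1 / 2 + phi f g ^ 2 / 4 := by
  rw [thm2AccProb, BuzetChailloux2026_thm1_odd hn f g hf hg]
  have h2 : Real.sqrt 2 ≠ 0 := Real.sqrt_ne_zero'.2 (by norm_num)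
  field_simp
  linear_combination (-4 * phi f g ^ 2) * Real.sq_sqrt (zero_le_two (α := ℝ))

/-- **Theorem 2 of Buzet–Chailloux, `n` even** (padded functions): `P_acc = 1/2 + Φ(f,g)²/8`.
[cite: BuzetChailloux2026, Thm. 2] -/
theorem BuzetChailloux2026_thm2_even (hn : Even n) (f g : (Fin n → Bool) → ℝ)
    (hf : ∀ x, f x ^ 2 = 1) (hg : ∀ x, g x ^ 2 = 1) :
    thm2AccProb (pad f) (pad g) = 1 / 2 + phi f g ^ 2 / 8 := by
  rw [thm2AccProb, BuzetChailloux2026_thm1_even hn f g hf hg]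
  ring

end BuzetChailloux

end Literature.Computability.QuantumComplexity

end
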